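import Mathlib
import Summits.Schanuel.Schanuel.Theses.RigidCore
import Summits.Schanuel.Schanuel.Theorems.RigidCoreMinimalCounterexampleInAclRankSplit
import Summits.Schanuel.Schanuel.Theorems.RigidCoreMinimalCounterexampleInAclMixedSector
import Summits.Schanuel.Schanuel.Theorems.RigidCoreMinimalCounterexampleInAclPureResidue

/-!
# THE PURE SPLIT: (S*) ⟺ (rank-2 pure exponential residue) ∧ (ranks ≥ 3) — crux stmt-Schanuel-0969

Route `RigidCore`, crux (S*) `MinimalCounterexampleInAcl` (item stmt-Schanuel-0969), line `kernel-arithmetic-selection`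
(lead prover-line-stmt-Schanuel-0969-c4-0), `--supports stmt-Schanuel-0969`; registered stubs `crux_iff_pureResidue_and_geThree`
and `crux_of_pureSparsityTwo_of_geThree`.

Assembles the three landed sector theorems of the line into the sharpest decomposition of the crux known to the tree:
* LOG SECTOR, every rank (`stub_cruxLogSector`, …LogSector.lean): all `e^{xᵢ}` algebraic;
* MIXED SECTOR, rank 2 (`stub_rankTwo_mixedSector`, …MixedSector.lean): some `e^{xᵢ}` transcendental and some non-zero
  integer combination with algebraic exponential — `acl`-membership WITHOUT finiteness of the mates (torsor self-selection);
* PURE SECTOR, rank 2: no non-zero integer combination has an algebraic exponential — open, and implied by PURE SPARSITY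
  (`stub_rankTwo_pureExp_of_pureSparsityTwo`, …PureResidue.lean).

Results: `rankTwo_iff_pureResidue` ((S*)₂ ⟺ its pure-sector part), `crux_iff_pureResidue_and_geThree`
((S*) ⟺ pure-sector part of (S*)₂ ∧ item stmt-14744), `crux_of_pureSparsityTwo_of_geThree` (PureSparsityTwo → item 14744 → (S*)),
`crux_iff_geThree_of_pureSparsityTwo`.  Compared with the landed `crux_iff_residues` (…RankSplit.lean: off-log acl-field residue)
and the glue item stmt-14765 (`SparsityTwo → GeThree → (S*)`), the rank-2 co-premise shrinks from `SparsityTwo` (crux 0971, three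
open atoms) to pure sparsity (0971's pure atoms §3b–c only; the flagship root-chain atom §3a is mixed and drops out).
-/

noncomputable section

set_option linter.dupNamespace false

open Complex Set FirstOrder

namespace Summit.Schanuel.Schanuel.Cruxes.MinimalCounterexampleInAcl.KernelArithmeticSelection

open Literature.NumberTheory.Transcendental (SchanuelRank IsDefinedOver zariskiDim)
open Literature.ModelTheory.ExponentialFields
open Summit.Schanuel.Schanuel.Theorems.AclSubsetLogFreeCore.Negative (expAcl)
open Summit.Schanuel.Schanuel.Theses.RigidCore (MinimalCounterexampleInAcl MinimalCounterexampleInAclGeThree SparsityTwo)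

/-! ## The rank-2 slice is its pure-sector part -/

/-- **(S*)₂ ⟺ its PURE-SECTOR part**: on the log sector the slice is `stub_cruxLogSector`, on the mixed sector it is
`stub_rankTwo_mixedSector`; only pure first failures (no non-zero integer combination with algebraic exponential) remain.
[cite: Kirby2010, Prop. 7.2] -/
theorem rankTwo_iff_pureResidue :
    (∀ x : Fin 2 → ℂ, x ∈ firstFailures 2 → ∀ i, x i ∈ expAcl) ↔
      ∀ x : Fin 2 → ℂ, x ∈ firstFailures 2 →
        (∀ M : Fin 2 → ℤ, M ≠ 0 → Transcendental ℚ (cexp (∑ i, (M i : ℂ) * x i))) → ∀ i, x i ∈ expAcl := by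
  refine ⟨fun h x hx _ i => h x hx i, fun h x hx i => ?_⟩
  by_cases halg : ∀ j, IsAlgebraic ℚ (cexp (x j))
  · exact stub_cruxLogSector 2 x hx halg i
  · obtain ⟨j, hj⟩ := not_forall.mp halg
    by_cases hmixed : ∃ M : Fin 2 → ℤ, M ≠ 0 ∧ IsAlgebraic ℚ (cexp (∑ i, (M i : ℂ) * x i))
    · obtain ⟨M, hM, hMalg⟩ := hmixed
      exact stub_rankTwo_mixedSector x hx ⟨j, hj⟩ M hM hMalg i
    · push Not at hmixed
      exact h x hx (fun M hM => hmixed M hM) i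

/-! ## The registered stubs -/

/-- **Registered stub `crux_iff_pureResidue_and_geThree` (PROVED): THE PURE SPLIT** — (S*) holds iff (i) every PURE rank-2
first failure (ℚ-linearly independent `x : Fin 2 → ℂ` with `trdeg ℚ(x, eˣ) < 2`, Schanuel in ranks `< 2`, and `e^{Σ Mᵢxᵢ}`
transcendental for every non-zero integer vector `M`) has both coordinates in `acl^{ℂ_exp}(∅)`, and (ii) item stmt-Schanuel-14744
(`MinimalCounterexampleInAclGeThree`, ranks `≥ 3`) holds.  Log sector (every rank) and mixed sector (rank 2) are theorems.
[cite: Kirby2010, Prop. 7.2] -/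
theorem crux_iff_pureResidue_and_geThree : Summit.Schanuel.Schanuel.Theses.RigidCore.MinimalCounterexampleInAcl ↔ ((∀ x : Fin 2 → ℂ, x ∈ Summit.Schanuel.Schanuel.Cruxes.MinimalCounterexampleInAcl.KernelArithmeticSelection.firstFailures 2 → (∀ M : Fin 2 → ℤ, M ≠ 0 → Transcendental ℚ (Complex.exp (∑ i, (M i : ℂ) * x i))) → ∀ i, x i ∈ Summit.Schanuel.Schanuel.Theorems.AclSubsetLogFreeCore.Negative.expAcl) ∧ Summit.Schanuel.Schanuel.Theses.RigidCore.MinimalCounterexampleInAclGeThree) := by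
  rw [minimalCounterexampleInAcl_iff_rankTwo_and_geThree, rankTwo_iff_pureResidue]

/-- **Registered stub `crux_of_pureSparsityTwo_of_geThree` (PROVED): (S*) from PURE SPARSITY at rank 2 and item stmt-14744** —
the glue stmt-14765 with its rank-2 co-premise `SparsityTwo` (crux stmt-0971) weakened to finiteness of the PURE ℚ-independent graph
points of ℚ-curves (`stub_rankTwo_pureExp_of_pureSparsityTwo` + the pure split). [cite: Kirby2010, Prop. 7.2] -/
theorem crux_of_pureSparsityTwo_of_geThree : (∀ W : Set (Fin 2 ⊕ Fin 2 → ℂ), Literature.NumberTheory.Transcendental.IsDefinedOver (⊥ : Subfield ℂ) W → Literature.NumberTheory.Transcendental.zariskiDim ℂ W < 2 → Set.Finite {x : Fin 2 → ℂ | LinearIndependent ℚ x ∧ Sum.elim x (Complex.exp ∘ x) ∈ W ∧ ∀ M : Fin 2 → ℤ, M ≠ 0 → Transcendental ℚ (Complex.exp (∑ i, (M i : ℂ) * x i))}) → Summit.Schanuel.Schanuel.Theses.RigidCore.MinimalCounterexampleInAclGeThree → Summit.Schanuel.Schanuel.Theses.RigidCore.MinimalCounterexampleInAcl := by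
  intro hPSp h₃
  exact crux_iff_pureResidue_and_geThree.2 ⟨stub_rankTwo_pureExp_of_pureSparsityTwo hPSp, h₃⟩

/-- **Under pure sparsity at rank 2, (S*) ⟺ item stmt-14744.** [cite: Kirby2010, Prop. 7.2] -/
theorem crux_iff_geThree_of_pureSparsityTwo
    (hPSp : ∀ W : Set (Fin 2 ⊕ Fin 2 → ℂ), IsDefinedOver (⊥ : Subfield ℂ) W → zariskiDim ℂ W < 2 →
      Set.Finite {x : Fin 2 → ℂ | LinearIndependent ℚ x ∧ Sum.elim x (cexp ∘ x) ∈ W ∧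
        ∀ M : Fin 2 → ℤ, M ≠ 0 → Transcendental ℚ (cexp (∑ i, (M i : ℂ) * x i))}) :
    MinimalCounterexampleInAcl ↔ MinimalCounterexampleInAclGeThree :=
  ⟨minimalCounterexampleInAclGeThree_of_minimalCounterexampleInAcl, crux_of_pureSparsityTwo_of_geThree hPSp⟩

/-- **The pure rank-2 residue of (S*) follows from `SparsityTwo`** (crux stmt-0971) — read-back linking the pure split to the
landed glue stmt-14765. [cite: Kirby2010, Prop. 7.2] -/
theorem pureResidue_of_sparsityTwo (hSp : SparsityTwo) :
    ∀ x : Fin 2 → ℂ, x ∈ firstFailures 2 →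
      (∀ M : Fin 2 → ℤ, M ≠ 0 → Transcendental ℚ (cexp (∑ i, (M i : ℂ) * x i))) → ∀ i, x i ∈ expAcl :=
  stub_rankTwo_pureExp_of_pureSparsityTwo (sparsityTwo_imp_pureSparsityTwo hSp)

end Summit.Schanuel.Schanuel.Cruxes.MinimalCounterexampleInAcl.KernelArithmeticSelection

end
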